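import Literature.MathematicalPhysics.QuantumLattice.EmeryThreeBandThermalCapFromGroundStateFloor
import Literature.MathematicalPhysics.QuantumLattice.EmeryThreeBandThermalClusterVectorFloor
import HarnessLib

/-!
# THERMAL ENERGY WINDOWS OF THE THREE-BAND MODEL FROM `T = 0` DATA: for every `2×2`-periodic equilibrium state at `β > 0`,
# `E_floor ≤ E_cell(ω) ≤ E_trial + 6 log 2/β` per `CuO₂` — the certified `T = 0` window, widened by the maximal entropy times the temperature

Topic `Literature/MathematicalPhysics/QuantumLattice` (family `hubbard`; crew hubbard-fast S2 «multi-band × T > 0», seat hubbard-box-p1). The energy words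
of the router boxes are `T = 0` statements (`emeryEnergyDensity`); a phase-map cell at temperature `T` wants the ENERGY of the thermal equilibrium states.
Composition of the Griffiths bracket in `β` (`emery_cellMeanEnergy_mem_Icc_of_bounds`, chord from `β` to `0`) with (i) the a-priori value `P_{2×2}(0) ≤ 2 log 2`
and the trial-vector floor `−βe/4 ≤ emeryCellPressure β θ` (`EmeryThreeBandThermalClusterVectorFloor`) for the UPPER edge, and (ii) the all-states cluster floor
(`IsPeriodic.le_mul_cellMeanEnergy_of_posSemidef_uniformPeriodicWeight`) for the LOWER edge:

* **`emery_cellEnergy_le_trial_add`** (`β > 0`): for an equilibrium `ω` at `(β, θ)` and a unit `Cu₄O₈` cluster vector with `Re⟨φ, h^G_θ φ⟩ ≤ e`,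
  `4·ē(ω) ≤ e/4 + 6 log 2/β` — the thermal energy per `CuO₂` is at most the `T = 0` trial cap `E_trial = e/4` plus `6 log 2 · k_B T`; abstract form
  `emery_cellEnergy_le_of_pressureFloor` (any certified `ℓ ≤ emeryCellPressure β θ` gives `4ē(ω) ≤ (6 log 2 − ℓ)/β`).
* **`emery_cellEnergy_ge_of_windowCertificate`**: `q₀/M ≤ 4·ē(ω)` for EVERY `2×2`-periodic state from a plus-window certificate (`H^w_B + G − q₀·1 ⪰ 0`, uniform
  weight of mass `M`) — the `T = 0` floor is a floor at every temperature; hence **`emery_cellEnergy_mem_Icc_of_groundStateData`**: the window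
  `[q₀/M, e/4 + 6 log 2/β]` per `CuO₂` for every equilibrium at `β > 0`.

Everything is PROVED (0 sorry); no definition, no named fact, no number. HONEST SCOPE: at cuprate temperatures `6 log 2 · k_B T ≈ 0.1 eV` per `CuO₂` at 300 K,
an order below today's `T = 0` window widths (≈ 2 eV per `CuO₂`): the `T = 0` window IS the thermal energy window for now.

## Tree / Mathlib search

REUSED: `emery_cellMeanEnergy_mem_Icc_of_bounds`, `emeryPressure_mem_Icc`, `emeryPressure`, `emeryCellPressure`, `card_cell_liebPeriods_eq` (`EmeryThreeBandThermalPressure`);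
`neg_mul_le_emeryCellPressure_of_rayleigh`, `blockTau/Ups/Nu` (`EmeryThreeBandThermalClusterVectorFloor`); `IsPeriodic.le_mul_cellMeanEnergy_of_posSemidef_uniformPeriodicWeight`,
`emeryWindow_fit_of_cuO4_subset` (`WeightedOpenClusterUniformWeightsPeriodic`, `EmeryThreeBandWindowFloorsPlus`); `InfVolFermionState.IsPerVarEquilibrium`.

## References

* R. B. Griffiths, J. Math. Phys. 5 (1964) 1215, eq. (39). [cite: Griffiths1964, Eq. (39) and Fig. 3]
* R. B. Israel, *Convexity in the Theory of Lattice Gases* (1979), Thm. I.2.4. [cite: Israel1979, Thm. I.2.4]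
* P. W. Anderson, Phys. Rev. 83 (1951) 1260, eq. (2). [cite: Anderson1951, eq. (2)]
-/

noncomputable section

open scoped ComplexOrder BigOperators
open Finset

namespace Literature.MathematicalPhysics.QuantumLattice

open Matrix HubbardWave0 Literature.Probability.LatticeModels ThermodynamicLimit ClusterLowerBound InfVolFermionState

/-- **UPPER EDGE, abstract**: a certified floor `ℓ ≤ emeryCellPressure β θ` (`β > 0`) gives, for every equilibrium `ω` at `(β,θ)`, `4·ē(ω) ≤ (6 log 2 − ℓ)/β`.
[cite: Griffiths1964, Eq. (39) and Fig. 3] [cite: Israel1979, Thm. I.2.4] -/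
theorem emery_cellEnergy_le_of_pressureFloor {β : ℝ} (hβ : 0 < β) {θ : Fin 14 → ℝ} {ω : InfVolFermionState 2}
    (h : ω.IsPerVarEquilibrium β liebPeriods (emeryInteraction θ) 1) {ℓ : ℝ} (hℓ : ℓ ≤ emeryCellPressure β θ) :
    4 * cellMeanEnergy liebPeriods (emeryInteraction θ) ω 1 ≤ (6 * Real.log 2 - ℓ) / β := by
  -- Griffiths chord from `β` to `0`: `ē(ω) ≤ (P(0) − P(β))/β`, with `P(0) ≤ 2 log 2` and `4P(β) − 2 log 2 ≥ ℓ`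
  have h0 : emeryPressure (β - β) θ ≤ 2 * Real.log 2 := by
    have h2 := (emeryPressure_mem_Icc (β - β) θ).2
    rw [sub_self, abs_zero, zero_mul, add_zero] at h2
    rw [sub_self]
    exact h2
  have hL : (ℓ + 2 * Real.log 2) / 4 ≤ emeryPressure β θ := by
    rw [emeryCellPressure] at hℓ; linarith
  have hw := (emery_cellMeanEnergy_mem_Icc_of_bounds h hβ hL le_rfl h0).2
  rw [le_div_iff₀ hβ] at hw ⊢
  have e : (2 * Real.log 2 - (ℓ + 2 * Real.log 2) / 4) / β * β = 2 * Real.log 2 - (ℓ + 2 * Real.log 2) / 4 := div_mul_cancel₀ _ hβ.ne'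
  nlinarith [hw, e]

/-- **UPPER EDGE FROM A CLUSTER VECTOR**: a unit `Cu₄O₈` cluster vector `φ` with `Re⟨φ, hubbardOpenBoxGP 1 12 (blockTau θ) (blockUps θ) (blockNu θ) φ⟩ ≤ e` gives,
for every equilibrium `ω` at `(β,θ)` (`β > 0`), `4·ē(ω) ≤ e/4 + 6 log 2/β` — thermal energy per `CuO₂` ≤ `T = 0` trial cap `+ 6 log 2 · k_B T`.
[cite: Griffiths1964, Eq. (39) and Fig. 3] [cite: Israel1979, Thm. I.2.4] -/
theorem emery_cellEnergy_le_trial_add {β : ℝ} (hβ : 0 < β) {θ : Fin 14 → ℝ} {ω : InfVolFermionState 2}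
    (h : ω.IsPerVarEquilibrium β liebPeriods (emeryInteraction θ) 1) {φ : Fock (Orb (Fin 1 ×ₗ Fin 12))} (hφ : star φ ⬝ᵥ φ = 1) {e : ℝ}
    (he : (star φ ⬝ᵥ (hubbardOpenBoxGP 1 12 (blockTau θ) (blockUps θ) (blockNu θ) *ᵥ φ)).re ≤ e) :
    4 * cellMeanEnergy liebPeriods (emeryInteraction θ) ω 1 ≤ e / 4 + 6 * Real.log 2 / β := by
  have hfl := neg_mul_le_emeryCellPressure_of_rayleigh hβ.le θ hφ he
  have h1 := emery_cellEnergy_le_of_pressureFloor hβ h hfl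
  have e1 : (6 * Real.log 2 - -(β * e) / 4) / β = e / 4 + 6 * Real.log 2 / β := by
    field_simp
    ring
  rw [e1] at h1
  exact h1

/-- **LOWER EDGE FOR EVERY STATE**: a plus-window certificate (`B ⊇` the plus, uniform weight of mass `M > 0`, multiplier `G` killed by periodic states,
`H^w_B[emeryInteraction θ] + G − q₀·1 ⪰ 0`) gives `q₀/M ≤ 4·ē(ω)` for EVERY `2×2`-periodic `ω` — at every temperature. [cite: Anderson1951, eq. (2)] -/
theorem emery_cellEnergy_ge_of_windowCertificate (θ : Fin 14 → ℝ) {ω : InfVolFermionState 2} (hω : ω.IsPeriodic liebPeriods)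
    {B : Finset (Site 2)} (hB : emeryCuO4Window ⊆ B) {M : ℝ} (hM : 0 < M)
    {G : FermionOp B} (hG0 : ∀ ω' : InfVolFermionState 2, ω'.IsPeriodic liebPeriods → (ω'.expect B G).re = 0) {q₀ : ℝ}
    (hq : ((⟨fun X => (uniformPeriodicWeight liebPeriods B M X : ℂ) • (emeryInteraction θ).Φ X⟩ : FermionInteraction 2).localHamiltonian B + G -
      (q₀ : ℂ) • (1 : FermionOp B)).PosSemidef) :
    q₀ / M ≤ 4 * cellMeanEnergy liebPeriods (emeryInteraction θ) ω 1 := by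
  obtain ⟨-, -, hP, hR⟩ := emeryInteraction_structure θ
  have h := hω.le_mul_cellMeanEnergy_of_posSemidef_uniformPeriodicWeight hP hR B M (emeryWindow_fit_of_cuO4_subset θ hB) hG0 hq
  rw [card_cell_liebPeriods_eq] at h
  push_cast at h
  rw [div_le_iff₀ hM]
  linarith

/-- **THE THERMAL ENERGY WINDOW FROM `T = 0` DATA**: for every equilibrium `ω` at `(β, θ)` (`β > 0`), a plus-window certificate and a unit cluster vector give
`q₀/M ≤ 4·ē(ω) ≤ e/4 + 6 log 2/β` (energy per `CuO₂`). [cite: Griffiths1964, Eq. (39) and Fig. 3] [cite: Anderson1951, eq. (2)] -/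
theorem emery_cellEnergy_mem_Icc_of_groundStateData {β : ℝ} (hβ : 0 < β) {θ : Fin 14 → ℝ} {ω : InfVolFermionState 2}
    (h : ω.IsPerVarEquilibrium β liebPeriods (emeryInteraction θ) 1)
    {B : Finset (Site 2)} (hB : emeryCuO4Window ⊆ B) {M : ℝ} (hM : 0 < M)
    {G : FermionOp B} (hG0 : ∀ ω' : InfVolFermionState 2, ω'.IsPeriodic liebPeriods → (ω'.expect B G).re = 0) {q₀ : ℝ}
    (hq : ((⟨fun X => (uniformPeriodicWeight liebPeriods B M X : ℂ) • (emeryInteraction θ).Φ X⟩ : FermionInteraction 2).localHamiltonian B + G -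
      (q₀ : ℂ) • (1 : FermionOp B)).PosSemidef)
    {φ : Fock (Orb (Fin 1 ×ₗ Fin 12))} (hφ : star φ ⬝ᵥ φ = 1) {e : ℝ}
    (he : (star φ ⬝ᵥ (hubbardOpenBoxGP 1 12 (blockTau θ) (blockUps θ) (blockNu θ) *ᵥ φ)).re ≤ e) :
    4 * cellMeanEnergy liebPeriods (emeryInteraction θ) ω 1 ∈ Set.Icc (q₀ / M) (e / 4 + 6 * Real.log 2 / β) :=
  ⟨emery_cellEnergy_ge_of_windowCertificate θ h.1 hB hM hG0 hq, emery_cellEnergy_le_trial_add hβ h hφ he⟩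

end Literature.MathematicalPhysics.QuantumLattice

end
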